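import Mathlib.NumberTheory.Chebyshev
import Mathlib.Algebra.Polynomial.Taylor
import Mathlib.Algebra.Polynomial.HasseDeriv
import Mathlib.RingTheory.Polynomial.Vieta
import Mathlib.Data.Nat.Factorization.Basic
import Mathlib.Data.Int.NatAbs
import Mathlib.Analysis.SpecialFunctions.Exp
import Mathlib.Analysis.Calculus.Deriv.Polynomial
import Mathlib.Analysis.Calculus.IteratedDeriv.Lemmas
import HarnessLib

/-!
# Fel'dman's binomial polynomials `Δ(z; N, H)` (Nesterenko–Waldschmidt 1996, §4, Lemma 4)

Yu. V. Nesterenko, M. Waldschmidt, *On the approximation of the values of exponential function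
and logarithm by algebraic numbers*, Mat. Zapiski 2 (1996) 23–42 (= arXiv:math/0002047), §4
(after Fel'dman 1960, Baker 1972, Matveev 1993): for integers `N ≥ 0`, `H ≥ 1`, written
`N = qH + r` with `1 ≤ r ≤ H`,

  `Δ(z; N, H) = (z(z+1)⋯(z+H-1)/H!)^q · z(z+1)⋯(z+r-1)/r!`,

**Lemma 4.** *Let `N ≥ 1`, `H ≥ 1`, `σ ≥ 0` and `x` be integers, `d_σ = ν(H)^σ`
(`ν(k) = lcm(1, 2, …, k)`). Then `d_σ · Δ^{(u)}(x; N, H) ∈ ℤ` for `0 ≤ u ≤ σ`, and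
(4.2) `log d_σ < (107/103) σ H`, (4.3) `∑_{u=0}^{σ} C(σ,u) |Δ^{(u)}(x; N, H)| < σ^σ e^{N+H} (1 + |x|/H)^N`.*

This file PROVES the integrality assertion and (4.3) (no named facts). (4.2) is the prime number
theorem input `ψ(H) ≤ 1.0388… H` (Rosser–Schoenfeld); the tree has `ψ(x) ≤ 1.0722 x + 7√x`
(`Literature.NumberTheory.LFunctions.psi_le_sylvester`) and Mathlib has
`Chebyshev.psi_eq_log_lcmUpto` (`ψ = log ∘ Nat.lcmUpto`); we do not restate them here.

## Rendering

We index the `N` linear factors by `i < N` with offsets `bᵢ = i % H`: the multiset `{i % H : i < N}`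
is `⌊N/H⌋` copies of `{0, …, H-1}` followed by `{0, …, (N % H) - 1}`, which is the printed multiset
(for `H ∣ N` the printed `(q, r) = (N/H - 1, H)`, otherwise `(⌊N/H⌋, N % H)`). So

* `FeldmanDelta.num R N H = ∏_{i<N} (X + (i % H)) ∈ R[X]` (the numerator, over any commutative ring),
* `FeldmanDelta.den N H = ∏_{i<N} (i % H + 1) = (H!)^{⌊N/H⌋} (N % H)! ∈ ℕ` (the denominator),
* `Δ(z; N, H) = num(z)/den` and `Δ^{(u)}(x)/u! = (hasseDeriv u num)(x)/den`, where
  `(hasseDeriv u num)(x) = (taylor x num).coeff u = ∑_{t ⊆ [0,N), #t = N-u} ∏_{i∈t} (x + bᵢ)`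
  (Vieta, `Finset.prod_X_add_C_coeff`).

## Main results

* `FeldmanDelta.den_dvd_lcmUpto_pow_mul_coeff_taylor` — **integrality**: for `x ∈ ℤ` and
  `u ≤ σ`, `den N H ∣ ν(H)^σ · (taylor x (num ℤ N H)).coeff u`, i.e. `ν(H)^σ Δ^{(u)}(x)/u! ∈ ℤ`
  (a fortiori the printed `d_σ Δ^{(u)}(x) ∈ ℤ`). Proof as printed (p. 4): for each prime `p`,
  `v_p(den) = ∑ₖ tₖ` with `tₖ = ⌊N/H⌋⌊H/pᵏ⌋ + ⌊(N % H)/pᵏ⌋ = #{i < N : pᵏ ∣ bᵢ + 1}`; among the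
  `N - u` factors `x + bᵢ`, `i ∈ t`, at least `tₖ - u` are multiples of `pᵏ` when `pᵏ ≤ H`
  (a block of `m` consecutive integers contains a multiple of `m`: the shift
  `i ↦ i - (pᵏ - 1 - ((-x) mod pᵏ))`, `card_filter_dvd_offset_succ_le`), and `tₖ = 0` when
  `pᵏ > H`; summing over `k` gives `v_p(den) ≤ σ v_p(ν(H)) + v_p(∏_{i∈t} (x + bᵢ))`.
* `FeldmanDelta.sum_choose_mul_hasse_le` — **(4.3)** in the form
  `∑_{u ≤ σ} C(σ,u) u! (hasseDeriv u (num ℝ N H))(y) ≤ σ^σ e^{N+H} (1 + y/H)^N · den N H` for real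
  `y ≥ 0` (each Hasse value is `≤ C(N,u) (y+H-1)^{N-u}`, `C(σ,u) u! ≤ σ^σ`, the binomial theorem,
  and `H^N ≤ e^{N+H} den N H` from `k^k ≤ e^k k!`), together with the domination
  `‖(hasseDeriv u (num ℂ N H))(z)‖ ≤ (hasseDeriv u (num ℝ N H))(‖z‖)` (`norm_hasse_num_le`).

## References
* [NesterenkoWaldschmidt1996] Yu. V. Nesterenko, M. Waldschmidt, Mat. Zapiski 2 (1996) 23–42
  = arXiv:math/0002047, §4 Lemma 4 and (4.1)–(4.4).
* E. M. Matveev, Mat. Zametki 54 (1993) 76–81 (the polynomials (4.1)); N. I. Fel'dman, Izv. AN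
  SSSR 24 (1960) (the case `H = N`); A. Baker, Acta Arith. 21 (1972) (the case `r = H`).
-/

noncomputable section

open Polynomial Finset
open scoped Nat

namespace Literature.NumberTheory.Transcendental

namespace FeldmanDelta

/-! ### Definitions -/

/-- The numerator `∏_{i<N} (X + (i % H))` of Fel'dman's `Δ(X; N, H)` over a commutative ring `R`.
[cite: NesterenkoWaldschmidt1996, §4 (4.1)] -/
def num (R : Type*) [CommRing R] (N H : ℕ) : R[X] :=
  ∏ i ∈ range N, (X + C ((i % H : ℕ) : R))

/-- The denominator `∏_{i<N} (i % H + 1) = (H!)^{⌊N/H⌋} (N % H)!` of `Δ(X; N, H)`.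
[cite: NesterenkoWaldschmidt1996, §4 (4.1)] -/
def den (N H : ℕ) : ℕ := ∏ i ∈ range N, (i % H + 1)

/-- `den N H > 0`. [folklore] -/
theorem den_pos (N H : ℕ) : 0 < den N H :=
  Finset.prod_pos fun _ _ => Nat.succ_pos _

/-- `den N H ≠ 0`. [folklore] -/
theorem den_ne_zero (N H : ℕ) : den N H ≠ 0 := (den_pos N H).ne'

/-! ### Taylor coefficients of the numerator (Hasse derivatives) -/

section taylor

variable {R : Type*} [CommRing R]

/-- `taylor x (num R N H) = ∏_{i<N} (X + (x + i % H))`. [folklore] -/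
theorem taylor_num (N H : ℕ) (x : R) :
    taylor x (num R N H) = ∏ i ∈ range N, (X + C (x + ((i % H : ℕ) : R))) := by
  rw [num, taylor_apply, Polynomial.prod_comp]
  refine Finset.prod_congr rfl fun i _ => ?_
  rw [add_comp, X_comp, C_comp, C_add]
  ring

/-- **Vieta**: the `u`-th Taylor coefficient of `num` at `x` (the value of the `u`-th Hasse
derivative) is `∑_{t ⊆ [0,N), #t = N - u} ∏_{i∈t} (x + i % H)` for `u ≤ N`. [folklore] -/
theorem coeff_taylor_num (N H : ℕ) (x : R) {u : ℕ} (hu : u ≤ N) :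
    (taylor x (num R N H)).coeff u =
      ∑ t ∈ (range N).powersetCard (N - u), ∏ i ∈ t, (x + ((i % H : ℕ) : R)) := by
  rw [taylor_num, Finset.prod_X_add_C_coeff _ _ (by rwa [card_range]), card_range]

/-- `deg num ≤ N`. [folklore] -/
theorem natDegree_num_le (N H : ℕ) : (num R N H).natDegree ≤ N := by
  rw [num]
  refine (natDegree_prod_le _ _).trans ?_
  refine (Finset.sum_le_card_nsmul _ _ 1 fun i _ => ?_).trans (by simp)
  exact natDegree_add_le_of_degree_le natDegree_X_le ((natDegree_C _).le.trans zero_le_one)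

/-- The Taylor coefficients of `num` beyond the degree vanish. [folklore] -/
theorem coeff_taylor_num_eq_zero (N H : ℕ) (x : R) {u : ℕ} (hu : N < u) :
    (taylor x (num R N H)).coeff u = 0 := by
  apply coeff_eq_zero_of_natDegree_lt
  rw [natDegree_taylor]
  exact lt_of_le_of_lt (natDegree_num_le N H) hu

/-- The value of the `u`-th Hasse derivative of `num` at `x` is the `u`-th Taylor coefficient.
[folklore] -/
theorem hasseDeriv_num_eval (N H u : ℕ) (x : R) :
    (hasseDeriv u (num R N H)).eval x = (taylor x (num R N H)).coeff u :=
  (taylor_coeff x (num R N H) u).symm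

end taylor

/-! ### Counting multiples of `m` in blocks of consecutive integers -/

/-- **The shift.** For `1 ≤ m ≤ H` and an integer `x`, there are at least as many `i < N` with
`m ∣ x + (i % H)` as with `m ∣ (i % H) + 1`: on each block of `H` consecutive indices the latter are
`i % H ∈ {m-1, 2m-1, …}`, and shifting them down by `m - 1 - ((-x) mod m) ∈ [0, m)` gives distinct
indices of the former kind in the same block. [cite: NesterenkoWaldschmidt1996, §4, proof of Lemma 4] -/
theorem card_filter_dvd_offset_succ_le (N H : ℕ) {m : ℕ} (hm : 1 ≤ m) (x : ℤ) :
    #{i ∈ range N | (m : ℤ) ∣ ((i % H : ℕ) : ℤ) + 1} ≤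
      #{i ∈ range N | (m : ℤ) ∣ x + ((i % H : ℕ) : ℤ)} := by
  -- `ρ = (-x) mod m`, `δ = m - 1 - ρ`
  have hm0 : (0 : ℤ) < m := by exact_mod_cast hm
  set ρ : ℕ := ((-x) % (m : ℤ)).toNat with hρ
  have hρnn : (0 : ℤ) ≤ (-x) % (m : ℤ) := Int.emod_nonneg _ hm0.ne'
  have hρZ : (ρ : ℤ) = (-x) % (m : ℤ) := Int.toNat_of_nonneg hρnn
  have hρm : ρ < m := by
    have : (-x) % (m : ℤ) < m := Int.emod_lt_of_pos _ hm0
    omega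
  have hxρ : (m : ℤ) ∣ x + ρ := by
    have h := Int.emod_add_mul_ediv (-x) m
    rw [hρZ]
    refine ⟨-((-x) / m), ?_⟩
    linarith
  set δ : ℕ := m - 1 - ρ with hδ
  have hδm : δ < m := by omega
  -- the shift `i ↦ i - δ`
  refine Finset.card_le_card_of_injOn (fun i => i - δ) ?_ ?_
  · intro i hi
    simp only [coe_filter, mem_range, Set.mem_setOf_eq] at hi ⊢
    obtain ⟨hiN, hdvd⟩ := hi
    -- `i % H ≥ m - 1 ≥ δ`
    have hmod : m - 1 ≤ i % H := by
      have h1 : (m : ℤ) ≤ ((i % H : ℕ) : ℤ) + 1 :=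
        Int.le_of_dvd (by positivity) hdvd
      omega
    have hδi : δ ≤ i % H := by omega
    refine ⟨by omega, ?_⟩
    -- `(i - δ) % H = i % H - δ`
    have hmod' : (i - δ) % H = i % H - δ := by
      rcases Nat.eq_zero_or_pos H with rfl | hH
      · simp
      · have hlt : i % H - δ < H := lt_of_le_of_lt (Nat.sub_le _ _) (Nat.mod_lt i hH)
        have hi_eq : i - δ = H * (i / H) + (i % H - δ) := by
          have := Nat.div_add_mod i H
          omega
        rw [hi_eq, Nat.mul_add_mod, Nat.mod_eq_of_lt hlt]
    rw [hmod', Nat.cast_sub hδi]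
    -- `x + (i % H) - δ = (x + ρ) + ((i % H) + 1) - m`
    have e : x + (((i % H : ℕ) : ℤ) - (δ : ℤ)) = (x + ρ) + ((((i % H : ℕ) : ℤ)) + 1) - m := by
      have : (δ : ℤ) = m - 1 - ρ := by omega
      rw [this]; ring
    rw [e]
    exact dvd_sub (dvd_add hxρ hdvd) dvd_rfl
  · intro i hi j hj hij
    simp only [coe_filter, mem_range, Set.mem_setOf_eq] at hi hj
    have hi' : δ ≤ i := by
      have h1 : (m : ℤ) ≤ ((i % H : ℕ) : ℤ) + 1 := Int.le_of_dvd (by positivity) hi.2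
      have : m - 1 ≤ i % H := by omega
      exact (by omega : δ ≤ i % H).trans (Nat.mod_le i H)
    have hj' : δ ≤ j := by
      have h1 : (m : ℤ) ≤ ((j % H : ℕ) : ℤ) + 1 := Int.le_of_dvd (by positivity) hj.2
      have : m - 1 ≤ j % H := by omega
      exact (by omega : δ ≤ j % H).trans (Nat.mod_le j H)
    simp only at hij
    omega

/-- If `m > H ≥ 1` then no `i` has `m ∣ (i % H) + 1`. [folklore] -/
theorem card_filter_dvd_offset_succ_eq_zero (N : ℕ) {H m : ℕ} (hH : 1 ≤ H) (hm : H < m) :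
    #{i ∈ range N | (m : ℤ) ∣ ((i % H : ℕ) : ℤ) + 1} = 0 := by
  rw [Finset.card_eq_zero, Finset.filter_eq_empty_iff]
  intro i _ hdvd
  have h1 : (m : ℤ) ≤ ((i % H : ℕ) : ℤ) + 1 := Int.le_of_dvd (by positivity) hdvd
  have h2 : i % H < H := Nat.mod_lt i hH
  omega

/-- The shift, in terms of natural-number divisibility of `|x + (i % H)|`. [folklore] -/
theorem card_filter_dvd_succ_le_card_filter_dvd_natAbs (N H : ℕ) {m : ℕ} (hm : 1 ≤ m) (x : ℤ) :
    #{i ∈ range N | m ∣ i % H + 1} ≤ #{i ∈ range N | m ∣ (x + ((i % H : ℕ) : ℤ)).natAbs} := by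
  have h := card_filter_dvd_offset_succ_le N H hm x
  have e1 : (range N).filter (fun i => (m : ℤ) ∣ ((i % H : ℕ) : ℤ) + 1) =
      (range N).filter (fun i => m ∣ i % H + 1) := by
    refine Finset.filter_congr fun i _ => ?_
    exact_mod_cast Int.natCast_dvd_natCast
  have e2 : (range N).filter (fun i => (m : ℤ) ∣ x + ((i % H : ℕ) : ℤ)) =
      (range N).filter (fun i => m ∣ (x + ((i % H : ℕ) : ℤ)).natAbs) := by
    refine Finset.filter_congr fun i _ => ?_
    exact Int.natCast_dvd
  rw [e1, e2] at h
  exact h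

/-! ### The `p`-adic valuation of the denominator -/

/-- A card of a filter as a sum of indicators (for double counting). [folklore] -/
theorem card_filter_eq_sum_ite {α : Type*} (s : Finset α) (P : α → Prop) [DecidablePred P] :
    (#(s.filter P) : ℕ) = ∑ a ∈ s, if P a then 1 else 0 := by
  rw [Finset.card_filter]

/-- **The key valuation inequality** ([NesterenkoWaldschmidt1996, §4], proof of Lemma 4): for a
prime `p`, `H ≥ 1`, `t ⊆ [0, N)` with `#t ≥ N - σ` and all `x + bᵢ ≠ 0` (`i ∈ t`),
`v_p(den N H) ≤ σ · v_p(ν(H)) + v_p(∏_{i∈t} |x + bᵢ|)`. [cite: NesterenkoWaldschmidt1996, §4 Lemma 4] -/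
theorem factorization_den_le (N H : ℕ) (hH : 1 ≤ H) (σ : ℕ) (x : ℤ) (t : Finset ℕ)
    (ht : t ⊆ range N) (hcard : N ≤ #t + σ) (hne : ∀ i ∈ t, x + ((i % H : ℕ) : ℤ) ≠ 0)
    {p : ℕ} (hp : p.Prime) :
    (den N H).factorization p ≤ σ * (Nat.lcmUpto H).factorization p +
      (∏ i ∈ t, (x + ((i % H : ℕ) : ℤ)).natAbs).factorization p := by
  classical
  set P : ℕ → ℕ := fun i => (x + ((i % H : ℕ) : ℤ)).natAbs with hP
  have hPpos : ∀ i ∈ t, 0 < P i := fun i hi => Int.natAbs_pos.mpr (hne i hi)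
  have hPne : ∀ i ∈ t, P i ≠ 0 := fun i hi => (hPpos i hi).ne'
  -- a uniform exponent bound `b`
  set b : ℕ := H + ∏ i ∈ t, P i + 1 with hb
  have hp2 : 2 ≤ p := hp.two_le
  have hbpow : b < p ^ b := Nat.lt_pow_self hp.one_lt
  have hprodpos : 0 < ∏ i ∈ t, P i := Finset.prod_pos hPpos
  have hb1 : ∀ i, i % H + 1 < p ^ b := by
    intro i
    have : i % H < H := Nat.mod_lt i hH
    omega
  have hb2 : ∀ i ∈ t, P i < p ^ b := by
    intro i hi
    have : P i ≤ ∏ j ∈ t, P j := Nat.le_of_dvd hprodpos (Finset.dvd_prod_of_mem P hi)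
    omega
  have hb3 : Nat.log p H < b := lt_of_le_of_lt (Nat.log_le_self p H) (by omega)
  -- LHS as a double sum
  have hL : (den N H).factorization p = ∑ k ∈ Ico 1 b, #{i ∈ range N | p ^ k ∣ i % H + 1} := by
    rw [den, Nat.factorization_prod fun i _ => Nat.succ_ne_zero _, Finset.sum_apply']
    simp_rw [fun i => Nat.factorization_eq_card_pow_dvd_of_lt hp (Nat.succ_pos (i % H)) (hb1 i),
      card_filter_eq_sum_ite]
    exact Finset.sum_comm
  -- RHS, part 1
  have hR1 : (Nat.lcmUpto H).factorization p = #{k ∈ Ico 1 b | p ^ k ≤ H} := by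
    rw [Nat.factorization_lcmUpto H hp]
    have e : (Ico 1 b).filter (fun k => p ^ k ≤ H) = Icc 1 (Nat.log p H) := by
      ext k
      simp only [mem_filter, mem_Ico, mem_Icc]
      constructor
      · rintro ⟨⟨h1, -⟩, hk⟩
        refine ⟨h1, ?_⟩
        by_contra hlt
        push Not at hlt
        have := (Nat.log_lt_iff_lt_pow hp.one_lt (by omega)).mp hlt
        omega
      · rintro ⟨h1, hk⟩
        refine ⟨⟨h1, by omega⟩, ?_⟩
        have : ¬ H < p ^ k := fun hlt => by
          have := (Nat.log_lt_iff_lt_pow hp.one_lt (by omega)).mpr hlt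
          omega
        omega
    rw [e, Nat.card_Icc]
    omega
  -- RHS, part 2
  have hR2 : (∏ i ∈ t, P i).factorization p = ∑ k ∈ Ico 1 b, #{i ∈ t | p ^ k ∣ P i} := by
    rw [Nat.factorization_prod fun i hi => hPne i hi, Finset.sum_apply']
    rw [Finset.sum_congr rfl fun i hi => Nat.factorization_eq_card_pow_dvd_of_lt hp (hPpos i hi) (hb2 i hi)]
    simp_rw [card_filter_eq_sum_ite]
    exact Finset.sum_comm
  -- termwise comparison
  have hterm : ∀ k ∈ Ico 1 b, #{i ∈ range N | p ^ k ∣ i % H + 1} ≤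
      σ * (if p ^ k ≤ H then 1 else 0) + #{i ∈ t | p ^ k ∣ P i} := by
    intro k hk
    have hk1 : 1 ≤ k := (mem_Ico.mp hk).1
    have hm1 : 1 ≤ p ^ k := Nat.one_le_pow _ _ hp.pos
    by_cases hkH : p ^ k ≤ H
    · rw [if_pos hkH, mul_one]
      have h1 := card_filter_dvd_succ_le_card_filter_dvd_natAbs N H hm1 x
      -- split `range N` into `t` and its complement
      have h2 : #{i ∈ range N | p ^ k ∣ P i} ≤ #{i ∈ t | p ^ k ∣ P i} + #(range N \ t) := by
        calc #{i ∈ range N | p ^ k ∣ P i}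
            ≤ #(((t.filter fun i => p ^ k ∣ P i)) ∪ (range N \ t)) := by
              refine Finset.card_le_card fun i hi => ?_
              simp only [mem_filter, mem_range] at hi
              simp only [mem_union, mem_filter, mem_sdiff, mem_range]
              by_cases hit : i ∈ t
              · exact Or.inl ⟨hit, hi.2⟩
              · exact Or.inr ⟨hi.1, hit⟩
          _ ≤ _ := Finset.card_union_le _ _
      have h3 : #(range N \ t) ≤ σ := by
        rw [Finset.card_sdiff_of_subset ht, card_range]
        omega
      have h1' : #{i ∈ range N | p ^ k ∣ i % H + 1} ≤ #{i ∈ range N | p ^ k ∣ P i} := h1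
      omega
    · rw [if_neg hkH, mul_zero, zero_add]
      push Not at hkH
      have h0 : #{i ∈ range N | p ^ k ∣ i % H + 1} = 0 := by
        rw [Finset.card_eq_zero, Finset.filter_eq_empty_iff]
        intro i _ hdvd
        have h1 : p ^ k ≤ i % H + 1 := Nat.le_of_dvd (Nat.succ_pos _) hdvd
        have h2 : i % H < H := Nat.mod_lt i hH
        omega
      rw [h0]
      exact Nat.zero_le _
  -- sum up
  rw [hL, hR1, hR2, card_filter_eq_sum_ite, Finset.mul_sum, ← Finset.sum_add_distrib]
  exact Finset.sum_le_sum hterm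

/-- **Integrality, product form**: for `H ≥ 1`, `t ⊆ [0, N)` with `#t ≥ N - σ`,
`den N H ∣ ν(H)^σ ∏_{i∈t} (x + (i % H))` in `ℤ`. [cite: NesterenkoWaldschmidt1996, §4 Lemma 4] -/
theorem den_dvd_lcmUpto_pow_mul_prod (N H : ℕ) (hH : 1 ≤ H) (σ : ℕ) (x : ℤ) (t : Finset ℕ)
    (ht : t ⊆ range N) (hcard : N ≤ #t + σ) :
    (den N H : ℤ) ∣ (Nat.lcmUpto H : ℤ) ^ σ * ∏ i ∈ t, (x + ((i % H : ℕ) : ℤ)) := by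
  classical
  by_cases hz : ∃ i ∈ t, x + ((i % H : ℕ) : ℤ) = 0
  · obtain ⟨i, hi, h0⟩ := hz
    rw [Finset.prod_eq_zero hi h0, mul_zero]
    exact dvd_zero _
  push Not at hz
  -- in `ℕ`
  have hN : den N H ∣ Nat.lcmUpto H ^ σ * ∏ i ∈ t, (x + ((i % H : ℕ) : ℤ)).natAbs := by
    have hne : Nat.lcmUpto H ^ σ * ∏ i ∈ t, (x + ((i % H : ℕ) : ℤ)).natAbs ≠ 0 := by
      refine mul_ne_zero (pow_ne_zero _ (Nat.lcmUpto_ne_zero H)) ?_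
      exact Finset.prod_ne_zero_iff.mpr fun i hi => Int.natAbs_ne_zero.mpr (hz i hi)
    rw [← Nat.factorization_le_iff_dvd (den_ne_zero N H) hne]
    intro p
    by_cases hp : p.Prime
    · rw [Nat.factorization_mul (pow_ne_zero _ (Nat.lcmUpto_ne_zero H))
        (Finset.prod_ne_zero_iff.mpr fun i hi => Int.natAbs_ne_zero.mpr (hz i hi)),
        Nat.factorization_pow]
      simp only [Finsupp.coe_add, Finsupp.coe_smul, Pi.add_apply, Pi.smul_apply, smul_eq_mul]
      exact factorization_den_le N H hH σ x t ht hcard hz hp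
    · rw [Nat.factorization_eq_zero_of_not_prime _ hp]
      exact Nat.zero_le _
  -- back to `ℤ`
  rw [Int.natCast_dvd, Int.natAbs_mul, Int.natAbs_pow, Int.natAbs_natCast]
  have e : (∏ i ∈ t, (x + ((i % H : ℕ) : ℤ))).natAbs = ∏ i ∈ t, (x + ((i % H : ℕ) : ℤ)).natAbs :=
    map_prod Int.natAbsHom _ _
  rw [e]
  exact hN

/-- **Lemma 4, integrality** ([NesterenkoWaldschmidt1996, §4]): for `H ≥ 1`, `x ∈ ℤ` and
`u ≤ σ`, `den N H ∣ ν(H)^σ · (taylor x (num ℤ N H)).coeff u`; since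
`Δ^{(u)}(x; N, H) = u! · (taylor x num).coeff u / den N H`, this is `ν(H)^σ Δ^{(u)}(x)/u! ∈ ℤ`,
hence the printed `d_σ Δ^{(u)}(x; N, H) ∈ ℤ`, `d_σ = ν(H)^σ`. [cite: NesterenkoWaldschmidt1996, §4 Lemma 4] -/
theorem den_dvd_lcmUpto_pow_mul_coeff_taylor (N H : ℕ) (hH : 1 ≤ H) {σ u : ℕ} (hu : u ≤ σ)
    (x : ℤ) :
    (den N H : ℤ) ∣ (Nat.lcmUpto H : ℤ) ^ σ * (taylor x (num ℤ N H)).coeff u := by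
  classical
  rcases Nat.lt_or_ge N u with hNu | hNu
  · rw [coeff_taylor_num_eq_zero N H x hNu, mul_zero]
    exact dvd_zero _
  rw [coeff_taylor_num N H x hNu, Finset.mul_sum]
  refine Finset.dvd_sum fun t ht => ?_
  rw [mem_powersetCard] at ht
  exact den_dvd_lcmUpto_pow_mul_prod N H hH σ x t ht.1 (by omega)

/-! ### The closed form of the denominator and the bound `H^N ≤ e^{N+H} den` -/

/-- `den (N+1) H = den N H · (N % H + 1)`. [folklore] -/
theorem den_succ (N H : ℕ) : den (N + 1) H = den N H * (N % H + 1) := by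
  rw [den, den, Finset.prod_range_succ]

/-- **`den N H = (H!)^{⌊N/H⌋} · (N % H)!`** for `H ≥ 1`. [cite: NesterenkoWaldschmidt1996, §4 (4.1)] -/
theorem den_eq (N : ℕ) {H : ℕ} (hH : 1 ≤ H) : den N H = (H !) ^ (N / H) * (N % H)! := by
  induction N with
  | zero => simp [den, Nat.zero_div, Nat.zero_mod]
  | succ N ih =>
    rw [den_succ, ih]
    have hdm := Nat.div_add_mod N H
    have hlt : N % H < H := Nat.mod_lt N hH
    by_cases h : N % H + 1 = H
    · -- a block is completed
      have hq : (N + 1) / H = N / H + 1 ∧ (N + 1) % H = 0 := by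
        rw [Nat.div_mod_unique hH]
        refine ⟨?_, hH⟩
        calc 0 + H * (N / H + 1) = H * (N / H) + H := by ring
          _ = N + 1 := by linarith
      rw [hq.1, hq.2, pow_succ, Nat.factorial_zero, mul_one, mul_assoc,
        mul_comm ((N % H)!) (N % H + 1), ← Nat.factorial_succ, h]
    · have hlt' : N % H + 1 < H := by omega
      have hq : (N + 1) / H = N / H ∧ (N + 1) % H = N % H + 1 := by
        rw [Nat.div_mod_unique hH]
        exact ⟨by linarith, hlt'⟩
      rw [hq.1, hq.2, Nat.factorial_succ]
      ring

/-- **`H^N ≤ e^{N+H} · den N H`** (`H ≥ 1`): with `N = qH + r`, `H^H ≤ e^H H!` and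
`H^r ≤ e^H r!` (terms of the exponential series). [cite: NesterenkoWaldschmidt1996, §4, proof of (4.3)] -/
theorem pow_le_exp_mul_den (N : ℕ) {H : ℕ} (hH : 1 ≤ H) :
    (H : ℝ) ^ N ≤ Real.exp ((N : ℝ) + H) * den N H := by
  set q := N / H with hq
  set r := N % H with hr
  have hN : H * q + r = N := Nat.div_add_mod N H
  have hH0 : (0 : ℝ) ≤ H := Nat.cast_nonneg _
  have hfH : (0 : ℝ) < (H ! : ℝ) := by exact_mod_cast Nat.factorial_pos H
  have hfr : (0 : ℝ) < (r ! : ℝ) := by exact_mod_cast Nat.factorial_pos r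
  have h1 : (H : ℝ) ^ H ≤ Real.exp H * H ! := by
    have := Real.pow_div_factorial_le_exp (H : ℝ) hH0 H
    rwa [div_le_iff₀ hfH] at this
  have h2 : (H : ℝ) ^ r ≤ Real.exp H * r ! := by
    have := Real.pow_div_factorial_le_exp (H : ℝ) hH0 r
    rwa [div_le_iff₀ hfr] at this
  rw [den_eq N hH]
  push_cast
  calc (H : ℝ) ^ N = ((H : ℝ) ^ H) ^ q * (H : ℝ) ^ r := by
        rw [← pow_mul, ← pow_add, hN]
    _ ≤ (Real.exp H * H !) ^ q * (Real.exp H * r !) := by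
        gcongr
    _ = Real.exp ((H * q : ℕ) + H) * ((H ! : ℝ) ^ q * r !) := by
        rw [mul_pow, ← Real.exp_nat_mul,
          show ((H * q : ℕ) : ℝ) + H = (q : ℝ) * H + H by push_cast; ring, Real.exp_add]
        ring
    _ ≤ Real.exp ((N : ℝ) + H) * ((H ! : ℝ) ^ q * r !) := by
        gcongr
        exact_mod_cast (by omega : H * q ≤ N)

/-! ### The size of the Hasse derivatives: (4.3) -/

/-- **Domination**: `‖(hasseDeriv k num_ℂ)(z)‖ ≤ (hasseDeriv k num_ℝ)(‖z‖)` (all coefficients of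
`num` are non-negative). [folklore] -/
theorem norm_hasseDeriv_num_eval_le (N H k : ℕ) (z : ℂ) :
    ‖(hasseDeriv k (num ℂ N H)).eval z‖ ≤ (hasseDeriv k (num ℝ N H)).eval ‖z‖ := by
  classical
  rcases Nat.lt_or_ge N k with hk | hk
  · rw [hasseDeriv_num_eval, hasseDeriv_num_eval, coeff_taylor_num_eq_zero N H z hk,
      coeff_taylor_num_eq_zero N H ‖z‖ hk, norm_zero]
  rw [hasseDeriv_num_eval, hasseDeriv_num_eval, coeff_taylor_num N H z hk,
    coeff_taylor_num N H ‖z‖ hk]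
  refine (norm_sum_le _ _).trans (Finset.sum_le_sum fun t _ => ?_)
  rw [norm_prod]
  refine Finset.prod_le_prod (fun i _ => norm_nonneg _) fun i _ => ?_
  calc ‖z + ((i % H : ℕ) : ℂ)‖ ≤ ‖z‖ + ‖((i % H : ℕ) : ℂ)‖ := norm_add_le _ _
    _ = ‖z‖ + ((i % H : ℕ) : ℝ) := by rw [Complex.norm_natCast]

/-- The real Hasse values at `y ≥ 0` are non-negative. [folklore] -/
theorem hasseDeriv_num_eval_nonneg (N H k : ℕ) {y : ℝ} (hy : 0 ≤ y) :
    0 ≤ (hasseDeriv k (num ℝ N H)).eval y := by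
  classical
  rcases Nat.lt_or_ge N k with hk | hk
  · rw [hasseDeriv_num_eval, coeff_taylor_num_eq_zero N H y hk]
  rw [hasseDeriv_num_eval, coeff_taylor_num N H y hk]
  exact Finset.sum_nonneg fun t _ => Finset.prod_nonneg fun i _ => by positivity

/-- **Each Hasse value is at most `C(N,k) (y + H - 1)^{N-k}`** (`y ≥ 0`, `H ≥ 1`, `k ≤ N`):
`C(N, k)` subsets, each product of `N - k` factors `≤ y + H - 1`.
[cite: NesterenkoWaldschmidt1996, §4, proof of (4.3)] -/
theorem hasseDeriv_num_eval_le (N : ℕ) {H : ℕ} (hH : 1 ≤ H) {y : ℝ} (hy : 0 ≤ y) {k : ℕ}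
    (hk : k ≤ N) :
    (hasseDeriv k (num ℝ N H)).eval y ≤ (N.choose k : ℝ) * (y + H - 1) ^ (N - k) := by
  classical
  rw [hasseDeriv_num_eval, coeff_taylor_num N H y hk]
  have hfac : ∀ i, y + ((i % H : ℕ) : ℝ) ≤ y + H - 1 := by
    intro i
    have : ((i % H : ℕ) : ℝ) + 1 ≤ H := by exact_mod_cast Nat.mod_lt i hH
    linarith
  calc ∑ t ∈ (range N).powersetCard (N - k), ∏ i ∈ t, (y + ((i % H : ℕ) : ℝ))
      ≤ ∑ t ∈ (range N).powersetCard (N - k), (y + H - 1) ^ (N - k) := by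
        refine Finset.sum_le_sum fun t ht => ?_
        rw [mem_powersetCard] at ht
        calc ∏ i ∈ t, (y + ((i % H : ℕ) : ℝ)) ≤ ∏ _i ∈ t, (y + H - 1) :=
              Finset.prod_le_prod (fun i _ => by positivity) fun i _ => hfac i
          _ = (y + H - 1) ^ (N - k) := by rw [Finset.prod_const, ht.2]
    _ = (N.choose k : ℝ) * (y + H - 1) ^ (N - k) := by
        rw [Finset.sum_const, Finset.card_powersetCard, card_range, nsmul_eq_mul,
          Nat.choose_symm hk]

/-- **(4.3)** ([NesterenkoWaldschmidt1996, §4, Lemma 4]) for the numerator: for `H ≥ 1` and real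
`y ≥ 0`, `∑_{k ≤ σ} C(σ,k) · k! · (hasseDeriv k num)(y) ≤ σ^σ e^{N+H} (1 + y/H)^N · den N H`, i.e.
`∑_{k ≤ σ} C(σ,k) Δ^{(k)}(y; N, H) ≤ σ^σ e^{N+H} (1 + y/H)^N` for `Δ = num/den` (the printed bound,
with `|x|` replaced by any real `y ≥ 0`). [cite: NesterenkoWaldschmidt1996, §4 Lemma 4 (4.3)] -/
theorem sum_choose_mul_factorial_mul_hasse_le (N σ : ℕ) {H : ℕ} (hH : 1 ≤ H) {y : ℝ}
    (hy : 0 ≤ y) :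
    ∑ k ∈ range (σ + 1), (σ.choose k : ℝ) * k ! * (hasseDeriv k (num ℝ N H)).eval y ≤
      (σ : ℝ) ^ σ * Real.exp ((N : ℝ) + H) * (1 + y / H) ^ N * den N H := by
  classical
  have hH0 : (0 : ℝ) < H := by exact_mod_cast hH
  have hb0 : 0 ≤ y + H - 1 := by
    have : (1 : ℝ) ≤ H := by exact_mod_cast hH
    linarith
  have hσσ : ∀ k ∈ range (σ + 1), ((σ.choose k : ℕ) : ℝ) * k ! ≤ (σ : ℝ) ^ σ := by
    intro k hk
    have hkσ : k ≤ σ := Nat.lt_succ_iff.mp (mem_range.mp hk)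
    have h1 : ((σ.choose k : ℕ) : ℝ) * k ! = (σ.descFactorial k : ℝ) := by
      rw [Nat.descFactorial_eq_factorial_mul_choose]; push_cast; ring
    rw [h1]
    calc (σ.descFactorial k : ℝ) ≤ (σ : ℝ) ^ k := by exact_mod_cast Nat.descFactorial_le_pow σ k
      _ ≤ (σ : ℝ) ^ σ := by
          rcases Nat.eq_zero_or_pos σ with rfl | hσ
          · have : k = 0 := by omega
            subst this; simp
          · exact pow_le_pow_right₀ (by exact_mod_cast hσ) hkσ
  -- termwise bound by `σ^σ · C(N,k) (y+H-1)^{N-k} · [k ≤ N]`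
  have hterm : ∀ k ∈ range (σ + 1),
      (σ.choose k : ℝ) * k ! * (hasseDeriv k (num ℝ N H)).eval y ≤
        (σ : ℝ) ^ σ * if k ≤ N then (N.choose k : ℝ) * (y + H - 1) ^ (N - k) else 0 := by
    intro k hk
    by_cases hkN : k ≤ N
    · rw [if_pos hkN]
      exact mul_le_mul (hσσ k hk) (hasseDeriv_num_eval_le N hH hy hkN)
        (hasseDeriv_num_eval_nonneg N H k hy) (by positivity)
    · rw [if_neg hkN, mul_zero, hasseDeriv_num_eval,
        coeff_taylor_num_eq_zero N H y (by omega), mul_zero]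
  refine (Finset.sum_le_sum hterm).trans ?_
  rw [← Finset.mul_sum, Finset.sum_ite, Finset.sum_const_zero, add_zero]
  -- the filtered sum is part of the binomial expansion of `(1 + (y + H - 1))^N`
  have hsub : (range (σ + 1)).filter (fun k => k ≤ N) ⊆ range (N + 1) := by
    intro k hk
    simp only [mem_filter, mem_range] at hk ⊢
    omega
  have hbin : ∑ k ∈ range (N + 1), (N.choose k : ℝ) * (y + H - 1) ^ (N - k) = (y + H) ^ N := by
    have h := (add_pow (1 : ℝ) (y + H - 1) N).symm
    simp only [one_pow, one_mul] at h
    rw [show (1 : ℝ) + (y + H - 1) = y + H by ring] at h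
    rw [← h]
    exact Finset.sum_congr rfl fun k _ => mul_comm _ _
  have hle : ∑ k ∈ (range (σ + 1)).filter (fun k => k ≤ N), (N.choose k : ℝ) * (y + H - 1) ^ (N - k)
      ≤ (y + H) ^ N := by
    rw [← hbin]
    exact Finset.sum_le_sum_of_subset_of_nonneg hsub fun k _ _ => by positivity
  have hpow : (y + H) ^ N ≤ Real.exp ((N : ℝ) + H) * (1 + y / H) ^ N * den N H := by
    have e : (y + H) ^ N = (H : ℝ) ^ N * (1 + y / H) ^ N := by
      rw [← mul_pow]; congr 1; field_simp; ring
    rw [e]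
    calc (H : ℝ) ^ N * (1 + y / H) ^ N ≤ (Real.exp ((N : ℝ) + H) * den N H) * (1 + y / H) ^ N :=
          mul_le_mul_of_nonneg_right (pow_le_exp_mul_den N hH) (by positivity)
      _ = _ := by ring
  calc (σ : ℝ) ^ σ * ∑ k ∈ (range (σ + 1)).filter (fun k => k ≤ N),
          (N.choose k : ℝ) * (y + H - 1) ^ (N - k)
      ≤ (σ : ℝ) ^ σ * (y + H) ^ N := mul_le_mul_of_nonneg_left hle (by positivity)
    _ ≤ (σ : ℝ) ^ σ * (Real.exp ((N : ℝ) + H) * (1 + y / H) ^ N * den N H) :=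
        mul_le_mul_of_nonneg_left hpow (by positivity)
    _ = _ := by ring

/-- **(4.3), complex form**: for `H ≥ 1` and `z ∈ ℂ`,
`∑_{k ≤ σ} C(σ,k) · k! · ‖(hasseDeriv k num)(z)‖ ≤ σ^σ e^{N+H} (1 + ‖z‖/H)^N · den N H`.
[cite: NesterenkoWaldschmidt1996, §4 Lemma 4 (4.3)] -/
theorem sum_choose_mul_factorial_mul_norm_hasse_le (N σ : ℕ) {H : ℕ} (hH : 1 ≤ H) (z : ℂ) :
    ∑ k ∈ range (σ + 1), (σ.choose k : ℝ) * k ! * ‖(hasseDeriv k (num ℂ N H)).eval z‖ ≤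
      (σ : ℝ) ^ σ * Real.exp ((N : ℝ) + H) * (1 + ‖z‖ / H) ^ N * den N H := by
  refine le_trans (Finset.sum_le_sum fun k _ => ?_)
    (sum_choose_mul_factorial_mul_hasse_le N σ hH (norm_nonneg z))
  exact mul_le_mul_of_nonneg_left (norm_hasseDeriv_num_eval_le N H k z) (by positivity)

/-! ### The link with derivatives of the entire function `z ↦ num(z)` -/

/-- Iterated derivatives of a polynomial function. [folklore] -/
theorem iteratedDeriv_polynomial_eval (p : ℂ[X]) (k : ℕ) :
    iteratedDeriv k (fun w => p.eval w) = fun w => (derivative^[k] p).eval w := by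
  induction k with
  | zero => simp
  | succ k ih =>
    rw [iteratedDeriv_succ, ih, Function.iterate_succ_apply']
    funext w
    exact Polynomial.deriv _

/-- `num^{(k)}(z) = k! · (hasseDeriv k num)(z)`. [folklore] -/
theorem iteratedDeriv_num_eval (N H k : ℕ) (z : ℂ) :
    iteratedDeriv k (fun w => (num ℂ N H).eval w) z = (k ! : ℂ) * (hasseDeriv k (num ℂ N H)).eval z := by
  rw [iteratedDeriv_polynomial_eval]
  have h := congrFun (factorial_smul_hasseDeriv (R := ℂ) (k := k)) (num ℂ N H)
  simp only [LinearMap.smul_apply] at h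
  rw [← h]
  simp only [nsmul_eq_mul, eval_mul, eval_natCast]

end FeldmanDelta

end Literature.NumberTheory.Transcendental

end
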